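import Summits.CriticalPhenomena.Ising3D.ExclusionSentencesGFD
import Literature.MathematicalPhysics.QuantumFieldTheory.ConformalBootstrap3D.PointKernelK57Sigma

/-!
# Region adapters: from a landed `IsingEnclosure W R` of ANY shape to the box form the bridges take

Cell `pub-ising3x`, recog-1 (SCOPE.md §3; phase-1 runbook `HOME/pub-ising3x-recog-1/PHASE1-RECOG-RUNBOOK.md`).
HONEST FRAMING: lottery ticket; floor = tightest certified 3D Ising CFT bounds; no exact-solution claim
without a proof.

Every exclusion bridge of the catalogue (`sigma_/eps_ne_rat_of_isingEnclosure`, `…_not_kac_…`,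
`pair_not_kacj_of_isingEnclosure`, `pair_not_gfd_of_isingEnclosure`, `beta_/gamma_ne_rat_…`, the
`ExclusionReport…` corollaries written by `kernel_report.py` / `pair_report.py`) takes the certified
statement as `h : IsingEnclosure W R` together with `hR : ∀ q ∈ R, (a ≤ q.1 ≤ b) ∧ (c ≤ q.2 ≤ d)`,
i.e. it wants the region INSIDE A RATIONAL BOX.  The floor's real statements are not boxes: the tree's
unconditional column certificate reads `IsingEnclosure {0.5165 ≤ Δσ ≤ 0.5185} {p | p.2 < 1.6 ∧ (p.1 ≤
0.5175 → p.2 < 1.5)}` (`PointKernelColumns.isingEnclosure_two_columns`, pub-ising3d, kernel-checked), and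
phase 1's M2-β / M3-γ statements will be one-sided column bounds and strips of the same kind.  This file
supplies the two-line adapter, once:

* `isingEnclosure_self W : IsingEnclosure W W`, `isingEnclosure_unitarity W` (axiom A1 as an enclosure:
  `1/2 ≤ Δσ`, `1/2 ≤ Δε`), `isingEnclosure_restrict` (`R ↦ R ∩ (W ∩ unitarity quadrant)`);
* **`isingEnclosure_toBox`**: if every point of `R` that lies in `W` and in the unitarity quadrant lies in
  the rational box `[a, b] × [c, d]`, then `IsingEnclosure W (Icc a b ×ˢ Icc c d)`; and `box_hR` /
  `box_hRσ` / `box_hRε`, the `hR` hypotheses of the bridges for a box region, proved once;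
* validation ON THE TREE'S OWN UNCONDITIONAL 3D CERTIFICATE (no hypothesis, no new certificate, no float
  digit): `twoColumns_boxed : IsingEnclosure {0.5165 ≤ Δσ ≤ 0.5185} ([0.5165, 0.5185] × [1/2, 8/5])`, and
  through it the first catalogue members refuted UNCONDITIONALLY in the kernel for the 3D `σ–ε` system —
  e.g. the ten members `(K, L) = (28, 17…26)` of Kaupužs' table (`Δσ = 29/56`, `Δε = 45/28 … 27/14 > 8/5`;
  `gfd28_not_attained_of_twoColumns`) and, generically, every pair of the column with `Δε > 8/5`
  (`pair_not_attained_of_twoColumns`).  These lie far from the float island (`Δε ≈ 1.41`): the content is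
  the end-to-end chain certificate → enclosure → box → catalogue sentence on a REAL theorem, which phase 1
  repeats on every certified rung; nothing here bears on the lottery.
-/

namespace Summit.CriticalPhenomena.Ising3D

open Set Literature.MathematicalPhysics.QuantumFieldTheory.ConformalBootstrap3D

/-! ### Generic adapters -/

/-- The window encloses itself. -/
theorem isingEnclosure_self (W : Set (ℝ × ℝ)) : IsingEnclosure W W := fun _ _ hW => hW

/-- Axiom A1 (unitarity: `1/2 ≤ Δσ`, `1/2 ≤ Δε`) as an enclosure of any window. -/
theorem isingEnclosure_unitarity (W : Set (ℝ × ℝ)) :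
    IsingEnclosure W {p | (1 / 2 : ℝ) ≤ p.1 ∧ (1 / 2 : ℝ) ≤ p.2} :=
  fun _ hD _ => ⟨hD.2.1.1, hD.2.1.2.1⟩

/-- Restrict the region of an enclosure to what the window and unitarity allow. -/
theorem isingEnclosure_restrict {W R : Set (ℝ × ℝ)} (h : IsingEnclosure W R) :
    IsingEnclosure W (R ∩ (W ∩ {p | (1 / 2 : ℝ) ≤ p.1 ∧ (1 / 2 : ℝ) ≤ p.2})) :=
  h.inter ((isingEnclosure_self W).inter (isingEnclosure_unitarity W))

/-- **Boxing an enclosure.** If every point of `R` lying in the window `W` and in the unitarity quadrant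
lies in the rational box `[a, b] × [c, d]`, then the enclosure holds with that box as its region — the shape
every catalogue bridge consumes (with `box_hR a b c d` as its `hR`). -/
theorem isingEnclosure_toBox {W R : Set (ℝ × ℝ)} (h : IsingEnclosure W R) {a b c d : ℚ}
    (hbox : ∀ q ∈ R, q ∈ W → (1 / 2 : ℝ) ≤ q.1 → (1 / 2 : ℝ) ≤ q.2 →
      ((a : ℝ) ≤ q.1 ∧ q.1 ≤ (b : ℝ)) ∧ ((c : ℝ) ≤ q.2 ∧ q.2 ≤ (d : ℝ))) :
    IsingEnclosure W (Icc (a : ℝ) b ×ˢ Icc (c : ℝ) d) := by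
  intro D hD hW
  obtain ⟨hR, hW', h1, h2⟩ := isingEnclosure_restrict h D hD hW
  exact mem_prod.mpr ⟨mem_Icc.mpr (hbox _ hR hW' h1 h2).1, mem_Icc.mpr (hbox _ hR hW' h1 h2).2⟩

/-- The `hR` hypothesis of the pair bridges for a box region. -/
theorem box_hR (a b c d : ℚ) :
    ∀ q ∈ Icc (a : ℝ) b ×ˢ Icc (c : ℝ) d, ((a : ℝ) ≤ q.1 ∧ q.1 ≤ (b : ℝ)) ∧ ((c : ℝ) ≤ q.2 ∧ q.2 ≤ (d : ℝ)) :=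
  fun _ hq => ⟨mem_Icc.mp (mem_prod.mp hq).1, mem_Icc.mp (mem_prod.mp hq).2⟩

/-- The `hR` hypothesis of the `Δσ` bridges for a box region. -/
theorem box_hRσ (a b c d : ℚ) : ∀ q ∈ Icc (a : ℝ) b ×ˢ Icc (c : ℝ) d, (a : ℝ) ≤ q.1 ∧ q.1 ≤ (b : ℝ) :=
  fun q hq => (box_hR a b c d q hq).1

/-- The `hR` hypothesis of the `Δε` bridges for a box region. -/
theorem box_hRε (a b c d : ℚ) : ∀ q ∈ Icc (a : ℝ) b ×ˢ Icc (c : ℝ) d, (c : ℝ) ≤ q.2 ∧ q.2 ≤ (d : ℝ) :=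
  fun q hq => (box_hR a b c d q hq).2

/-- A point of the window outside the box is not attained (the boxed form of
`point_not_attained_of_isingEnclosure`). -/
theorem point_not_attained_of_toBox {W R : Set (ℝ × ℝ)} (h : IsingEnclosure W R) {a b c d : ℚ}
    (hbox : ∀ q ∈ R, q ∈ W → (1 / 2 : ℝ) ≤ q.1 → (1 / 2 : ℝ) ≤ q.2 →
      ((a : ℝ) ≤ q.1 ∧ q.1 ≤ (b : ℝ)) ∧ ((c : ℝ) ≤ q.2 ∧ q.2 ≤ (d : ℝ)))
    {v : ℝ × ℝ} (hvW : v ∈ W) (hv : v.1 < a ∨ (b : ℝ) < v.1 ∨ v.2 < c ∨ (d : ℝ) < v.2)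
    (D : SigmaEpsilonData) (hD : D.SatisfiesBootstrapAxioms) : (D.Δσ, D.Δε) ≠ v := by
  refine point_not_attained_of_isingEnclosure (isingEnclosure_toBox h hbox) hvW ?_ D hD
  intro hvR
  obtain ⟨⟨h1, h2⟩, h3, h4⟩ := box_hR a b c d v hvR
  rcases hv with hv | hv | hv | hv <;> linarith

/-! ### Validation on the tree's unconditional 3D column certificate (pub-ising3d; no hypothesis) -/

/-- The window of `PointKernelColumns.isingEnclosure_two_columns`: the column `0.5165 ≤ Δσ ≤ 0.5185`. -/
def twoColumnsW : Set (ℝ × ℝ) := {p | (0.5165 : ℝ) ≤ p.1 ∧ p.1 ≤ 0.5185}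

/-- **The tree's two-column certificate, boxed**: every `σ–ε` datum satisfying A0–A5 with
`0.5165 ≤ Δσ ≤ 0.5185` has `(Δσ, Δε) ∈ [0.5165, 0.5185] × [1/2, 8/5]` (from `Δε < 1.6` of the certificate
and `1/2 ≤ Δε` of A1).  Unconditional. -/
theorem twoColumns_boxed :
    IsingEnclosure twoColumnsW
      (Icc (((5165 / 10000 : ℚ) : ℝ)) ((5185 / 10000 : ℚ) : ℝ) ×ˢ
        Icc (((1 / 2 : ℚ) : ℝ)) ((8 / 5 : ℚ) : ℝ)) := by
  refine isingEnclosure_toBox PointKernelColumns.isingEnclosure_two_columns ?_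
  intro q hR hW _ h2
  obtain ⟨hlt, -⟩ := hR
  obtain ⟨hw1, hw2⟩ := hW
  push_cast
  refine ⟨⟨by linarith, by linarith⟩, h2, by linarith⟩

/-- **Generic consequence**: no `σ–ε` datum satisfying A0–A5 has `(Δσ, Δε) = (x, y)` with
`0.5165 ≤ x ≤ 0.5185` and `y > 8/5` (or `y < 1/2`).  Unconditional; far from the float island — the
content is the chain, not the numbers. -/
theorem pair_not_attained_of_twoColumns {x y : ℝ} (hx1 : (0.5165 : ℝ) ≤ x) (hx2 : x ≤ 0.5185)
    (hy : y < 1 / 2 ∨ (8 / 5 : ℝ) < y) (D : SigmaEpsilonData) (hD : D.SatisfiesBootstrapAxioms) :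
    (D.Δσ, D.Δε) ≠ (x, y) := by
  refine point_not_attained_of_isingEnclosure twoColumns_boxed (show (x, y) ∈ twoColumnsW from ⟨hx1, hx2⟩)
    ?_ D hD
  intro hvR
  obtain ⟨-, h3, h4⟩ := box_hR _ _ _ _ (x, y) hvR
  push_cast at h3 h4
  rcases hy with hy | hy <;> linarith

/-- **Catalogue instance (quarantined family `GFD`, NAMED-late-3)**: the ten members `(K, L) = (28, L)`,
`17 ≤ L ≤ 26`, of Kaupužs' table — `(Δσ, Δε) = (29/56, (28 + L)/28)`, `Δσ = 0.517857…` inside the column,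
`Δε ≥ 45/28 > 8/5` — are attained by NO `σ–ε` datum satisfying the typed axioms A0–A5 (stated for every
`L ≥ 17`; the table's members are those with `L ≤ 26`).  The first members
of an in-print closed-form table for 3D Ising refuted unconditionally in the kernel (by pub-ising3d's column
certificate); all ten are `≥ 0.19` above the float `Δε`, i.e. irrelevant to the lottery. -/
theorem gfd28_not_attained_of_twoColumns {L : ℕ} (hL : 17 ≤ L) (D : SigmaEpsilonData)
    (hD : D.SatisfiesBootstrapAxioms) :
    (D.Δσ, D.Δε) ≠ (((gfdPair3 28 L).1 : ℝ), ((gfdPair3 28 L).2 : ℝ)) := by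
  have hLq : (17 : ℚ) ≤ L := by exact_mod_cast hL
  have e1 : (gfdPair3 28 L).1 = 29 / 56 := by norm_num [gfdPair3]
  have e2 : (8 / 5 : ℚ) < (gfdPair3 28 L).2 := by
    simp only [gfdPair3]
    rw [lt_div_iff₀ (by norm_num)]
    push_cast
    linarith
  have e2' := (Rat.cast_lt (K := ℝ)).mpr e2
  push_cast at e2'
  refine pair_not_attained_of_twoColumns ?_ ?_ (Or.inr e2') D hD
  · rw [e1]; norm_num
  · rw [e1]; norm_num

/-- The same members ARE in the cell's window `W = [0.505, 0.535] × [1.2, 1.6]`? No — their `Δε > 8/5`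
puts them just above its upper face; recorded so that nobody counts them as in-`W` refutations. -/
theorem gfd28_above_W {L : ℕ} (hL : 17 ≤ L) : (16 / 10 : ℚ) < (gfdPair3 28 L).2 := by
  have hLq : (17 : ℚ) ≤ L := by exact_mod_cast hL
  simp only [gfdPair3]
  rw [lt_div_iff₀ (by norm_num)]
  push_cast
  linarith

end Summit.CriticalPhenomena.Ising3D
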